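import Summits.HodgeConjecture.HodgeConjecture.Theorems.F0P2nFrobeniusFunctional            -- ★ K1b `isConstituentOf_mk_cmPrincipalSeries_xi_of_functional` (F0P2-p01 (g6))
import Literature.NumberTheory.GelbartRogawski1991.WeilLiftNonsplitPrincipalSeriesConstituent  -- letter #76 vocabulary (`xThetaCM`, `ThetaTypeAtCM`, `cmDatumLocalCongr`, …)
import Literature.NumberTheory.Rogawski1990.XiLocalCharacter                               -- ★ `cmXiTorusChar`
import Summits.HodgeConjecture.HodgeConjecture.Theorems.F0P2oK1wOfWeylConj               -- ★ p826576 F0P2-p02 (g5): K1w consumer `stubK1w_of_weylConj (hW)` (edition v3)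
import Literature.NumberTheory.Rogawski1990.U3PrincipalSeriesWeylConjugate                  -- ★ p826332 typ-T7a (g0): THE K1w LETTER `cmPrincipalSeries_isConstituentOf_weylConj`
import Summits.HodgeConjecture.HodgeConjecture.Theorems.F0P2oXThetaOwnClass               -- ★ p827560 F0P2-p05 (g0): K1c closer `stubK1c_holds` (edition v3b; generic half ★ p827125 `F0P2oThetaTypeOwnClass`)
import Summits.HodgeConjecture.HodgeConjecture.Theorems.F0P2oK1aWOfLetters              -- ★ p828026 B-p18 (g28): K1aʷ closer `stubK1aW_of_letters (hN3) (hU1)` (edition v3c)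
import Literature.NumberTheory.GelbartRogawski1991.ThetaTypeNonsplitJacquetModule            -- ★ p826177 typ-T7a (g0): THE N3 LETTER `thetaType_nonsplit_jacquetModule`
import Literature.NumberTheory.GelbartRogawski1991.U1ThetaDichotomy                          -- ★ p826953 ∕ ED.2 p827180 typ-T7b (g0): THE U1 LETTER `u1ThetaDichotomy_nonsplit`
import Summits.HodgeConjecture.HodgeConjecture.Theorems.F0P2pK1wHolds     -- ★ p833012 F0P2-p06 (g2): K1w HYPOTHESIS-FREE `cmPrincipalSeries_isConstituentOf_weylConj_holds` (= ★ p832032 `_of_N1` over ★ p832625 N1), BY NAME («HOLDS FOLD»)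
import Summits.HodgeConjecture.HodgeConjecture.Theorems.F0P2pGR91NOfN3    -- ★ p833094 F0P2-p06 (g2): `u1ThetaDichotomy_nonsplit_of_N3 (hN3)` (U1 modulo N3 only: ★ p829230 tower ∘ ★ p832406∕p833741 CM head ∘ ★ p832625 N1), BY NAME («HOLDS FOLD»)
import Summits.HodgeConjecture.HodgeConjecture.Theorems.F0P2oN3OfTorusWeight   -- ★ p835661 F0P2-p06 (g3): THE N3 PACKAGER `thetaType_nonsplit_jacquetModule_of_a_of_torusWeight (hA) (hD)` over ★ p835430 (b)-assembler `F0P2oN3TorusWeightOfD3d`, BY NAME («N3 SPLIT», edition v3e)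
import Summits.HodgeConjecture.HodgeConjecture.Theorems.F0P2oN3TorusWeightHolds   -- ★ A-p16 (g24) (5c): `forall_jacquetModule_xThetaGqsCM_torus_eq_smul` = the packager՚s (hD) binder PROVED (token for token) ⇒ `stub_N3D_letter` closed BY NAME («N3D FOLD»)
import Summits.HodgeConjecture.HodgeConjecture.Theorems.F0P2oLineJacquetHolds   -- ★ p839151 F0P2-p06 (g4) (JA): `thetaType_nonsplit_jacquetModule_holds : GelbartRogawski1991.thetaType_nonsplit_jacquetModule` HYPOTHESIS-FREE ⇒ `stub_N3_letter` closed BY NAME («N3 DIRECT FOLD»)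
import HarnessLib

/-!
# Crux `H413`, programme P2, pay-down line `F0_P2GR91NJacquet` — THE K1 SUB-SKELETON (lead B-p18 (g27)): K1 ⟸ K1aʷ «Jacquet functional for χθ^w» + K1w «Weyl symmetry» + K1c «own class»
# over ★ K1b (Frobenius ⟹ constituent) — `k1_of_stubs : StubK1aJacquetFunctional → StubK1cOwnClass → ‹StubThetaInPS›`

Cell hodgecm-mathlib (D-0151), FLOOR 0, crux item H413 = stmt-HodgeConjecture-24833, socket 27455; pay-down line `Cruxes/H413/Lines/F0_P2GR91NJacquet.lean`
(03185efdbb79 ∕ 8624ae7daed8e64a; F0P2-plan (g7); director s561 (4)), registered stub K1 `stub_thetaType_in_principalSeries : StubThetaInPS` (:86–101), lead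
B-p18 (g27) (desk GO 14:38:23Z), plan `F0/P2/B-p18/K1-PLAN.v0.B-p18g27.md` (5804a4e083551f2c).  NO `Lines` import: `CenterCharSpec` and the K1 text are PASTED
(O50-1), so the fold is `stub_thetaType_in_principalSeries := F0P2GR91NJacquetK1.k1_of_stubs stub_K1a stub_K1c` by defeq of the pasted `def`s.
HC_CM is proved only modulo the printed citations until rung 0 closes; this file proves no letter — it CUTS K1 and kernel-checks the composition.

## Edition v3f «N3 DIRECT FOLD» (desk F0P2-plan (g9), 2026-09-01; proof-only for every SURVIVING statement, every surviving statement and head byte-unchanged; the clause-(a) stub `stub_N3a_letter` of v3e is DROPPED (N1-DROP precedent: its only consumer was the body of `stub_N3_letter`); supersedes v3e b927bd4e5446).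
The N3 letter #96 [GelbartRogawski1991 §3.2 (3.2.1)–(3.2.2) p. 457; Kudla1986 Thm. 2.8] `GelbartRogawski1991.thetaType_nonsplit_jacquetModule` — the LAST local print letter of programme P2 below the packet letters — is ★ CLOSED BY NAME, HYPOTHESIS-FREE, by the η-free (N′) line-Jacquet road:
`stub_N3_letter := Summit.HodgeConjecture.HodgeConjecture.Cruxes.H413.F0P2oLineJacquetHolds.thetaType_nonsplit_jacquetModule_holds`
(★ p839151 F0P2-p06 (g4) `Theorems/F0P2oLineJacquetHolds.lean :: thetaType_nonsplit_jacquetModule_holds` (the (JA) junction over ★ (C5) p838835 B-p10 (g23), ★ (C6)∕(J1)–(J4) p838314 B-p14 (g29) + `F0P2oLineJacquetReindex`, ★ (BE) p838099∕p838184 B-p18 (g29), ★ (N′) p837961 F0P2-p06 (g4), ★ (LS) p836839, ★ (LM) p836568, ★ (FX)(CC) p837171∕p837965, ★ (BF) p837182, ★ (BD) p838316, ★ (IB) p838392, ★ (KL) p838305, ★ (SJ-gen) p838357; lead B-p18 (g29) socket (B) word 2026-08-31T23:47:37Z); conclusion = the Literature named fact BY NAME; the fold line elaborating is the certificate).  +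 import ★ `Theorems.F0P2oLineJacquetHolds`.  Sorry set of this file after v3f: {} — the K1 sub-line is SORRY-FREE: `stub_N3_letter`, `stub_U1_letter`, `stub_K1aW` and the head `k1_of_stubs_registered : K1Target` are THEOREMS of the tree HYPOTHESIS-FREE (axioms expected [propext, Classical.choice, Quot.sound]).  BOOKS: #96 N3 closes on the HYPOTHESIS-FREE Theorems-level proof of `GelbartRogawski1991.thetaType_nonsplit_jacquetModule` (director՚s pen, s527 criterion (i)); this edition is the consumer catch-up BY NAME.
HC_CM is proved only modulo the printed citations until rung 0 closes.

## Edition v3e «N3 SPLIT + N3D FOLD» (desk F0P2-plan (g8), 2026-08-31T22Z; director s705 DENOMINATION: #96 N3 stays ONE books row, re-denominated BY NAME to the packager՚s open print inputs; proof-only for every existing statement, heads byte-unchanged; supersedes v3d d21c3291a669).  `stub_N3_letter` [GelbartRogawski1991 §3.2 (3.2.1)–(3.2.2) p. 457; Kudla1986 Thm. 2.8] is ★ CLOSED BY NAME over F0P2-p06 (g3)՚s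
★ p835661 `F0P2oN3OfTorusWeight.thetaType_nonsplit_jacquetModule_of_a_of_torusWeight stub_N3a_letter stub_N3D_letter` (packager over the ★ p835430 (b)-assembler `F0P2oN3TorusWeightOfD3d`: clause (b) of
the letter — the `m(γ)`-weight on `r_N(X_v)` read through the (D3d) undoubling∕coinvariant bricks ★ p834000 · p834249 · p835415 · p835416 · p835417 · p835587 · p835588 · p835613 (A-p16 (g24)) — is PROVED modulo
(hD); clause (a) is (hA)).  TWO NEW PRINT-RESIDUE STUBS, typed TOKEN FOR TOKEN as the packager՚s binders (extracted by script from the TREE bytes dc6083d4a23e6b99 of the ★ file, lines :83–:100 ∕ :101–:117,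
under its `open` ∕ `set_option` context via `set_option … in open … in`; the fold line elaborating is the fidelity certificate): `stub_N3a_letter` = clause (a) «`r_N(X_v(μ, ε, χ_f)) ≃ ℱ_v[ψθ]` as a `C`-line: the Borel
coinvariants of `X_v` are the `ψθ ∘ det`-weight space of the rank-one line Weil representation» [GelbartRogawski1991 §3.2 (3.2.1) p. 457; Kudla1986 Thm. 2.8 (top filtration piece = ev₀)] (in-house road, lead B-p18 (g29):
(S4) ★ p834408 ∘ CM closer ★ p832817 ∘ chart sockets ★ p834949∕p835111 (A-p12 (g17)) ∘ F0P2-p01 (g8)՚s (E1) ★ p835408 ∕ (E2) ∕ (E3) ★ p835407 ∕ (N) ∕ (W) dictionary; B-p18 (g29) 22:04:27Z rows (LS) local see-saw + (FN) frame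
naturality; B-p10 (g22) (1b) ★ p835647) and `stub_N3D_letter` = the torus weight «`m(γ)` acts on `r_N(X_v)` by `μ_w(γ)‖γ‖_w^{1/2}`» [Kudla1986 Thm. 2.8; Rogawski1990 §12.2 (2) p. 174] (in-house: A-p16 (g24)՚s (5b) CM-package
wrapper `Theorems/F0P2oThetaJacquetTorusWeight.lean` over ★ p835613 (5a) ⇒ ★ `F0P2oN3TorusWeightOfD3d.thetaType_nonsplit_jacquetModule_b_of_kerWeight`, ★ p835944; and (5c) ★ p836093 `F0P2oN3TorusWeightHolds.forall_jacquetModule_xThetaGqsCM_torus_eq_smul` PROVES the (hD) binder token for token ⇒ `stub_N3D_letter` is ★ CLOSED BY NAME in this edition — #96 N3 hinges on clause (a) ALONE).  Sorry set of this file after v3e: {`stub_N3a_letter`} — `K1Target` ⟸ {N3 (a)} kernel-checked.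
HC_CM is proved only modulo the printed citations until rung 0 closes.

## Edition v3d «HOLDS FOLD — THE K1 SUB-LINE IS CLOSED MODULO ONE PRINT LETTER (N3)» (desk F0P2-plan (g8), 2026-08-31T22Z; proof-only: every statement text and the head §4 byte-unchanged; supersedes v3c 794a220ca631)
`stub_K1w_letter := F0P2pK1wHolds.cmPrincipalSeries_isConstituentOf_weylConj_holds` (★ p833012 F0P2-p06 (g2): K1w HYPOTHESIS-FREE — ★ p832032 `…_of_N1` over ★ p832625 B-p10 (g21)
`U3PrincipalSeriesJacquetFiltration_holds`; books: #107 N1 CLOSED s671, #98 K1w CLOSED-derived s677) and `stub_U1_letter := F0P2pGR91NOfN3.u1ThetaDichotomy_nonsplit_of_N3 stub_N3_letter`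
(★ p833094 F0P2-p06 (g2): U1 MODULO N3 ONLY — ★ p829230 B-p18 (g28) tower ∘ ★ p832406∕p833741 CM head ∘ ★ p832625 N1; books: #97 U1 CLOSED-derived s677).  Imports + ★ p833012, + ★ p833094
(both Lines-free `Theorems/` files, O50-1 kept).  OPEN after v3d: the ONE `sorry` of §3 is the print letter `stub_N3_letter` (#96; in-house N3 road live: ★ p835430 F0P2-p06 (g3) (b)-assembler `F0P2oN3TorusWeightOfD3d` + packager `thetaType_nonsplit_jacquetModule_of_a_of_torusWeight (hA) (hD)` GREEN, (a)-side ★ p834861∕p834949∕p835111 A-p12 (g17) + F0P2-p01 (g8) (S5)∕(E·) bricks, (b)-side A-p16 (g24) (D3d) bricks, lead B-p18 (g29)).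
Same fold as T7 `Lines/F0_P2XiLocalPacketThetaPair.lean` v1.4 (8e8104642623) and PKΠ `Lines/F0_P2PKPiRung4.lean` v1.11; the parent `Lines/F0_P2GR91NJacquet.lean` v1.3 carries it too.
HC_CM is proved only modulo the printed citations until rung 0 closes.

## Edition v3c «K1aʷ FOLD UNDER THE LETTERS N3 + U1 — ALL PRINT, ZERO ENGINE» (desk F0P2-plan (g8), 2026-08-31; lead B-p18 (g28) 16:08:53Z tokens; supersedes v3b 0bd9385256e8 =
the K1c + K1w folds, and v3a 368644d96141 = the K1w fold alone)
K1aʷ := `F0P2oK1aWOfLetters.stubK1aW_of_letters stub_N3_letter stub_U1_letter` (★ p828026 B-p18 (g28): ψθ-existence uniform in the line + ★ K1occ p827347 `k1occ_of_u1ThetaDichotomy`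
+ ★ p827685 `thetaType_nonsplit_borelEigenfunctional_of_jacquetModule` (N3ᵟ ⟸ N3 over ★ K1m p827378); the closer spells `CenterCharSpec` by its token-identical ★ Literature twin
`GelbartRogawski1991.IsThetaCenterChar` (p826013), so the fold elaborates by δ-unfolding, as K2 ∕ K1c did); K1w := `F0P2oK1wOfWeylConj.stubK1w_of_weylConj stub_K1w_letter` (★ p826576
over the ★ letter p826332); K1c := `F0P2oXThetaOwnClass.stubK1c_holds` (★ p827560, letter-free).
Print letters by name in this file (each a `sorry` over a ★-typed `def … : Prop` — a printed citation, not engine work): `stub_N3_letter` [GelbartRogawski1991 §3.2 (3.2.1)–(3.2.2)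
p. 457; Kudla1986 Thm. 2.8] `GelbartRogawski1991.thetaType_nonsplit_jacquetModule` (★ p826177), `stub_U1_letter` [HarrisKudlaSweet1996 Cor. 4.4 p. 962; Rogawski1992 Prop. 3.4]
`GelbartRogawski1991.u1ThetaDichotomy_nonsplit` (★ p826953 ∕ ED.2 p827180; in-house residual row «U1-DISJOINT», road (T) «up the tower», pay-down token
`F0P2oK1occ.u1ThetaDichotomy_nonsplit_of_dichotomy`), `stub_K1w_letter` [Rogawski1990 §12.2 p. 174] `Rogawski1990.cmPrincipalSeries_isConstituentOf_weylConj` (★ p826332; in-house road (A)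
F0P2-p06: N1 + N6 letters + F1 ★ p827152 → F2 → F3).
OPEN after v3c: NO ENGINE STUB — the three `sorry`s of §3 are the print letters N3, U1, K1w; `k1_of_stubs_registered` is kernel-checked over them.
All statement texts (§1 `CenterCharSpec`, §2 `StubK1aWJacquetFunctional` ∕ `StubK1wWeylSymmetric` ∕ `StubK1cOwnClass` ∕ `K1Target`) and the head §4 are byte-unchanged from v2 (35c8d923f732624c).
Parent fold (edition v1.2 of `Lines/F0_P2GR91NJacquet.lean`): NOT by a `Lines → Lines` import — lead B-p18 (g28)'s `Theorems/` composition `F0P2oThetaInPSOfLetters.stubThetaInPS_of_letters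
(hN3) (hW) (hU1) : ‹K1 body›` over the three closers + ★ K1b, then `stub_thetaType_in_principalSeries := … stub_N3_letter stub_K1w_letter stub_U1_letter` in the parent (by name, as Rung3 ∕ PKΠ).
HC_CM is proved only modulo the 2 remaining named inputs (hLiu418, h413) — behind them the booked printed statements + the MOD package — until rung 0 closes.

## The cut
`πG := X_v(μ, ε, χ_f) ∘ κ_v⁻¹ ∘ (congr_T)` — Liu's local theta type `xThetaCM … ε v` of `U(diag dV)(L⁺_v)` read on the quasi-split model `Gqs L v` through the frame
congruence `κ_v = localCongr … g` and the form congruence `cmDatumLocalCongr L v T ha h` (then `localPiEquiv`); spelled INLINE in both stubs (same term).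
* K1a `StubK1aJacquetFunctional` (L): `∃ ε ψθ, CenterCharSpec ∧ ∃ ℓ ≠ 0` on the carrier of `X_v` with `ℓ (πG p w) = χθ(proj p)·δ_B^{1/2}(p)·ℓ w` on the Borel
  `(cmBorelTriple L 3 v).P`, `χθ = cmXiTorusChar L v μ_v ψθ⁻¹ ψθ` (Kudla's filtration along the Borel + the `U(1)×U(1)` occurrence; sub-cut ORIENT ∕ N ∕ U(1) ∕ ≠0 in the plan).
* K1c `StubK1cOwnClass` (S–M): for every `ε`, `πG` is irreducible and smooth (★ IV-1a∕IV-2 at `N = 3`, non-split) and `ThetaTypeAtCM` holds for ITS OWN transported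
  class `comap (congr_T)⁻¹ ⟦πG⟧` (reflexivity of «is the theta type» up to the ★ constituent∕isotypic bookkeeping).
* K1b is ★ `F0P2nFrobeniusFunctional.isConstituentOf_mk_cmPrincipalSeries_xi_of_functional` and is used BY NAME in the head.

## References
* [GelbartRogawski1991] S. Gelbart, J. Rogawski, Invent. Math. 105 (1991): §5.1 (5.1.1) p. 465, Lemma 5.1.2 pp. 465–466.
* [Rogawski1990] J. Rogawski, Ann. of Math. Stud. 123 (1990): §12.1 p. 172, §12.2 (2) p. 174.
* [Kudla1986] S. Kudla, Invent. Math. 83 (1986): Thm. 2.8.  [HarrisKudlaSweet1996] JAMS 9 (1996): §6.  [BernsteinZelevinsky1976] §2.28.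
-/

set_option autoImplicit false
-- the mandated namespace has the single-problem summit's repeated segment (`HodgeConjecture.HodgeConjecture`)
set_option linter.dupNamespace false

noncomputable section

open NumberField IsDedekindDomain MeasureTheory
open scoped Matrix

open Literature.NumberTheory Literature.NumberTheory.Automorphic Literature.NumberTheory.Automorphic.UnitaryGroup
open Literature.NumberTheory.Automorphic.IdeleClassGroup
open Literature.NumberTheory.Automorphic.Liu2021 Literature.NumberTheory.Automorphic.Liu2021.Def411WeilCarriers
open Literature.NumberTheory.GaloisRepresentations
open Literature.NumberTheory.Rogawski1990
open Literature.NumberTheory.GelbartRogawski1991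

namespace Summit.HodgeConjecture.HodgeConjecture.Cruxes.H413.F0P2GR91NJacquetK1

/-! ## §1 Pasted text of the line: `CenterCharSpec` (:63–72 VERBATIM) -/

set_option synthInstance.maxHeartbeats 400000 in
set_option maxHeartbeats 8000000 in
/-- **`CenterCharSpec L μ χf ε v ψθ` — «`ψθ` is the U(1)-character of the local theta type read on `E¹_v`»**: for every `u` in the local unitary group
`U((ε))(L⁺_v)` of the line (★ `localPi … 1 (JW ε) v`, = `E¹_v` through ★ `localDet`), `ψθ (det u) = χ_{f,v}(u) · μ_v(det u)⁻¹` (★ `localCharOfCenter`, ★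
`HeckeCharacter.semilocalComponent`).  By §2 of the design memo this is the character `ψ_v` of Rogawski's `ξ = (η, ψ)` whenever `(μ, χ_f)` is the dictionary pair of
`ξ` — but it is stated over `(μ, χ_f)` ALONE.  A Prop, no data: the line posits no new character, it constrains a binder. [cite: GelbartRogawski1991, §5.1 (5.1.1) p. 465]
[cite: Rogawski1990, §12.2 (2) p. 174] -/
def CenterCharSpec (L : Type) [Field L] [NumberField L] [IsCMField L]
    (μ : Literature.NumberTheory.Automorphic.IdeleClassGroup L →ₜ* Circle)
    (χf : UnitaryGroup.finAdelicOne (↥(maximalRealSubfield L)) L (IsCMField.complexConj L) →* ℂˣ) (ε : (↥(maximalRealSubfield L))ˣ)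
    (v : HeightOneSpectrum (𝓞 ↥(maximalRealSubfield L))) (ψθ : ↥(normOneUnits (conjLocal L (IsCMField.complexConj L) v)) →* ℂˣ) : Prop :=
  ∀ u : ↥(localPi L (IsCMField.complexConj L) 1 (JW (↥(maximalRealSubfield L)) L ε) v),
    ψθ (localDet (IsCMField.complexConj L) v (isUnit_iff_ne_zero.mpr (by rw [Matrix.det_fin_one]; exact JW_apply_ne_zero (↥(maximalRealSubfield L)) L ε)) (localPiEquiv L (IsCMField.complexConj L) 1 (JW (↥(maximalRealSubfield L)) L ε) v u)) =
      localCharOfCenter (↥(maximalRealSubfield L)) L (IsCMField.complexConj L) (JW (↥(maximalRealSubfield L)) L ε) (JW_apply_ne_zero (↥(maximalRealSubfield L)) L ε) χf v u *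
        ((toHeckeCharacter L μ).semilocalComponent L v
          ((localDet (IsCMField.complexConj L) v (isUnit_iff_ne_zero.mpr (by rw [Matrix.det_fin_one]; exact JW_apply_ne_zero (↥(maximalRealSubfield L)) L ε)) (localPiEquiv L (IsCMField.complexConj L) 1 (JW (↥(maximalRealSubfield L)) L ε) v u) : ↥(normOneUnits (conjLocal L (IsCMField.complexConj L) v))) :
            (UnitaryGroup.LocalRing L v)ˣ))⁻¹

/-! ## §2 The two stub statements and the K1 target (pasted) -/

set_option synthInstance.maxHeartbeats 400000 in
set_option maxHeartbeats 8000000 in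
/-- **K1aʷ «JACQUET FUNCTIONAL» for the w-CONJUGATE character `χθ^w = μ_v‖·‖^{-1/2} ⊗ ψθ` (L, THE CORE; v2: the theta type `πⁿ` EMBEDS into `i_G(χθ^w)`, not `i_G(χθ)` — exponent finding 14:50:53Z).**  For the K1 data (CM frame, `μ`, unitary continuous `χ_f`, non-split `v`, form congruence), SOME line
class `ε` and SOME `ψθ` with ★ `CenterCharSpec` admit a NON-ZERO linear functional `ℓ` on the carrier of Liu's local theta type `X_v(μ, ε, χ_f)` which is a
`(B, χθ·δ_B^{1/2})`-eigenfunctional for the Borel `B = (cmBorelTriple L 3 v).P` of the quasi-split model acting through `πG = X_v ∘ κ_v⁻¹ ∘ congr_T`,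
`χθ = cmXiTorusChar L v μ_v ψθ⁻¹ ψθ` (`χθ(d(α,β,ᾱ⁻¹)) = μ_v(α)‖α‖^{1/2}ψθ(β)`), `δ_B^{1/2}` evaluated AT `p` (★ `rootDeltaChar`; p01's shape, so that ★ K1b applies by
`exact`).  Print: Kudla's filtration of the Jacquet module of the Weil representation along the Borel (top quotient `μ‖·‖^{1/2} ⊗ ω_{U(V₁)×U(W)}`) and the
`U(1) × U(1)` occurrence fixing `ε`.  Why it might fail as typed: ORIENTATION (`μ_v(α)` vs `μ_v(α)⁻¹` on `GL(ℓ)`, plan §2 — run K1a-orient FIRST).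
[cite: Kudla1986, Thm. 2.8] [cite: HarrisKudlaSweet1996, §6] [cite: GelbartRogawski1991, §5.1 (5.1.1) p. 465, Lem. 5.1.2 pp. 465–466] -/
def StubK1aWJacquetFunctional : Prop :=
  ∀ (L : Type) [Field L] [NumberField L] [IsCMField L] (H : Matrix (Fin 3) (Fin 3) L) (hH : (H.map (cmConjRingHom L))ᵀ = H) (hHd : IsUnit H.det)
    {n' : ℕ} (e₁ : Fin 3 × Fin 1 ≃ Fin n') (dV : Fin 3 → L) (hdV : ∀ i, IsCMField.complexConj L (dV i) = dV i) (hdV0 : ∀ i, dV i ≠ 0) (g : GL (Fin 3) L)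
    (hg : ((g : Matrix (Fin 3) (Fin 3) L).map (cmConjRingHom L))ᵀ * H * (g : Matrix (Fin 3) (Fin 3) L) = Matrix.diagonal dV),
    ∀ (μ : Literature.NumberTheory.Automorphic.IdeleClassGroup L →ₜ* Circle) (hμ : IsConjugateSymplectic L μ)
      (χf : UnitaryGroup.finAdelicOne (↥(maximalRealSubfield L)) L (IsCMField.complexConj L) →* ℂˣ),
      Continuous χf → (∀ z, ‖((χf z : ℂˣ) : ℂ)‖ = 1) →
      ∀ (v : HeightOneSpectrum (𝓞 ↥(maximalRealSubfield L))),
        (∀ w : PlacesOver L v, IsCMField.complexConj L • w.1 = w.1) →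
        ∀ (T : GL (Fin 3) (UnitaryGroup.LocalRing L v)) (a : UnitaryGroup.LocalRing L v) (ha : IsUnit a)
          (h : formCongr (conjLocal L (IsCMField.complexConj L) v) T (H.map (algebraMap L (UnitaryGroup.LocalRing L v))) =
            a • (Matrix.of fun i j : Fin 3 => if i.val + j.val + 1 = 3 then (1 : L) else 0).map (algebraMap L (UnitaryGroup.LocalRing L v))),
          ∃ (ε : (↥(maximalRealSubfield L))ˣ) (ψθ : ↥(normOneUnits (conjLocal L (IsCMField.complexConj L) v)) →* ℂˣ),
            CenterCharSpec L μ χf ε v ψθ ∧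
            ∃ ℓ : _ →ₗ[ℂ] ℂ, ℓ ≠ 0 ∧
              haveI := locallyCompactSpace_cmBorelU L 3 v
              ∀ (p : ↥(cmBorelTriple L 3 v).P) (w : _),
                ℓ ((((xThetaCM L e₁ dV hdV hdV0 μ hμ χf ε v :
              localPi L (IsCMField.complexConj L) 3 (Matrix.diagonal dV) v →* _).comp
              (localCongr L (IsCMField.complexConj L) g one_ne_zero (by rw [one_smul]; exact hg) v).symm.toMulEquiv.toMonoidHom).comp
            ((cmDatumLocalCongr L v T ha h).trans (localPiEquiv L (IsCMField.complexConj L) 3 H v).symm).toMulEquiv.toMonoidHom) p.1 w) =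
                  (((cmXiTorusChar L v ((toHeckeCharacter L μ).semilocalComponent L v * ((halfModulusChar (UnitaryGroup.LocalRing L v)) ^ 2)⁻¹) ψθ⁻¹ ψθ) ((cmBorelTriple L 3 v).proj p) : ℂˣ) : ℂ) *
                    ((rootDeltaChar (cmBorelTriple L 3 v).P p : ℂˣ) : ℂ) * ℓ w

set_option synthInstance.maxHeartbeats 400000 in
set_option maxHeartbeats 8000000 in
/-- **K1c «OWN CLASS» (S–M).**  For the K1 data and EVERY line class `ε`: `πG = X_v(μ, ε, χ_f) ∘ κ_v⁻¹ ∘ congr_T` is IRREDUCIBLE and SMOOTH (★ rank-one theta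
IV-1a irreducible-or-zero + IV-2 non-vanishing, `N = 3` isotropic at a non-split `v`; smoothness of the coinvariants of a smooth Weil representation), and
`ThetaTypeAtCM … ε v` holds for its OWN class transported back along `congr_T` (every representation isotypic for a constituent of the irreducible `X_v ∘ κ_v⁻¹`
is `X_v ∘ κ_v⁻¹`-isotypic).  In-house bookkeeping over ★ `IrrClass.comap`, ★ `IsConstituentOf`, ★ `isotypicComponent`.
[cite: Liu2021, App. D Lem. D.1 (1)] [cite: MoeglinVignerasWaldspurger1987, Chap. 3 §IV.2 Lemme p. 76] [cite: BourbakiAlgebreVIII2012, VIII §4 n°2] -/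
def StubK1cOwnClass : Prop :=
  ∀ (L : Type) [Field L] [NumberField L] [IsCMField L] (H : Matrix (Fin 3) (Fin 3) L) (hH : (H.map (cmConjRingHom L))ᵀ = H) (hHd : IsUnit H.det)
    {n' : ℕ} (e₁ : Fin 3 × Fin 1 ≃ Fin n') (dV : Fin 3 → L) (hdV : ∀ i, IsCMField.complexConj L (dV i) = dV i) (hdV0 : ∀ i, dV i ≠ 0) (g : GL (Fin 3) L)
    (hg : ((g : Matrix (Fin 3) (Fin 3) L).map (cmConjRingHom L))ᵀ * H * (g : Matrix (Fin 3) (Fin 3) L) = Matrix.diagonal dV),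
    ∀ (μ : Literature.NumberTheory.Automorphic.IdeleClassGroup L →ₜ* Circle) (hμ : IsConjugateSymplectic L μ)
      (χf : UnitaryGroup.finAdelicOne (↥(maximalRealSubfield L)) L (IsCMField.complexConj L) →* ℂˣ),
      Continuous χf → (∀ z, ‖((χf z : ℂˣ) : ℂ)‖ = 1) →
      ∀ (v : HeightOneSpectrum (𝓞 ↥(maximalRealSubfield L))),
        (∀ w : PlacesOver L v, IsCMField.complexConj L • w.1 = w.1) →
        ∀ (T : GL (Fin 3) (UnitaryGroup.LocalRing L v)) (a : UnitaryGroup.LocalRing L v) (ha : IsUnit a)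
          (h : formCongr (conjLocal L (IsCMField.complexConj L) v) T (H.map (algebraMap L (UnitaryGroup.LocalRing L v))) =
            a • (Matrix.of fun i j : Fin 3 => if i.val + j.val + 1 = 3 then (1 : L) else 0).map (algebraMap L (UnitaryGroup.LocalRing L v))),
          ∀ (ε : (↥(maximalRealSubfield L))ˣ),
            ∃ (hirr : Representation.IsIrreducible (((xThetaCM L e₁ dV hdV hdV0 μ hμ χf ε v :
              localPi L (IsCMField.complexConj L) 3 (Matrix.diagonal dV) v →* _).comp
              (localCongr L (IsCMField.complexConj L) g one_ne_zero (by rw [one_smul]; exact hg) v).symm.toMulEquiv.toMonoidHom).comp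
            ((cmDatumLocalCongr L v T ha h).trans (localPiEquiv L (IsCMField.complexConj L) 3 H v).symm).toMulEquiv.toMonoidHom))
              (hsm : Representation.IsSmooth (((xThetaCM L e₁ dV hdV hdV0 μ hμ χf ε v :
              localPi L (IsCMField.complexConj L) 3 (Matrix.diagonal dV) v →* _).comp
              (localCongr L (IsCMField.complexConj L) g one_ne_zero (by rw [one_smul]; exact hg) v).symm.toMulEquiv.toMonoidHom).comp
            ((cmDatumLocalCongr L v T ha h).trans (localPiEquiv L (IsCMField.complexConj L) 3 H v).symm).toMulEquiv.toMonoidHom)),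
              ThetaTypeAtCM L H e₁ dV hdV hdV0 g hg μ hμ χf ε v
                (IrrClass.comap (cmDatumLocalCongr L v T ha h).symm
                  (IrrClass.mk ⟨_, (((xThetaCM L e₁ dV hdV hdV0 μ hμ χf ε v :
              localPi L (IsCMField.complexConj L) 3 (Matrix.diagonal dV) v →* _).comp
              (localCongr L (IsCMField.complexConj L) g one_ne_zero (by rw [one_smul]; exact hg) v).symm.toMulEquiv.toMonoidHom).comp
            ((cmDatumLocalCongr L v T ha h).trans (localPiEquiv L (IsCMField.complexConj L) 3 H v).symm).toMulEquiv.toMonoidHom), hirr, hsm⟩))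

set_option synthInstance.maxHeartbeats 400000 in
set_option maxHeartbeats 8000000 in
/-- **K1w «WEYL SYMMETRY OF THE PRINCIPAL SERIES» (S–M, generic; NOT ★ yet).**  For the K1 data and every `ψθ`: a constituent of `i_G(χθ^w)`,
`χθ^w = cmXiTorusChar L v (μ_v·‖·‖⁻¹) ψθ⁻¹ ψθ` (`= μ_v(α)‖α‖^{-1/2}ψθ(β)`), is a constituent of `i_G(χθ)`, `χθ = cmXiTorusChar L v μ_v ψθ⁻¹ ψθ` — «`i_G(χ)` and `i_G(wχ)`
have the same constituents» [Rogawski1990, §12.1 p. 172] (intertwining operator; for conjugate-symplectic `μ`, `μ(ᾱ⁻¹) = μ(α)`, so `wχθ = χθ^w`).  Quoted in the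
docstring of ★ `UnitaryGroupBorelInduction.xiTorusChar` (:443) but not proved in the tree; typer-first letter or an in-house intertwining-operator file.
[cite: Rogawski1990, §12.1 p. 172, §12.2 (2) p. 174] [cite: BernsteinZelevinsky1976, §2.28] -/
def StubK1wWeylSymmetric : Prop :=
  ∀ (L : Type) [Field L] [NumberField L] [IsCMField L] (H : Matrix (Fin 3) (Fin 3) L) (hH : (H.map (cmConjRingHom L))ᵀ = H) (hHd : IsUnit H.det)
    {n' : ℕ} (e₁ : Fin 3 × Fin 1 ≃ Fin n') (dV : Fin 3 → L) (hdV : ∀ i, IsCMField.complexConj L (dV i) = dV i) (hdV0 : ∀ i, dV i ≠ 0) (g : GL (Fin 3) L)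
    (hg : ((g : Matrix (Fin 3) (Fin 3) L).map (cmConjRingHom L))ᵀ * H * (g : Matrix (Fin 3) (Fin 3) L) = Matrix.diagonal dV),
    ∀ (μ : Literature.NumberTheory.Automorphic.IdeleClassGroup L →ₜ* Circle) (hμ : IsConjugateSymplectic L μ)
      (χf : UnitaryGroup.finAdelicOne (↥(maximalRealSubfield L)) L (IsCMField.complexConj L) →* ℂˣ),
      Continuous χf → (∀ z, ‖((χf z : ℂˣ) : ℂ)‖ = 1) →
      ∀ (v : HeightOneSpectrum (𝓞 ↥(maximalRealSubfield L))),
        (∀ w : PlacesOver L v, IsCMField.complexConj L • w.1 = w.1) →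
        ∀ (T : GL (Fin 3) (UnitaryGroup.LocalRing L v)) (a : UnitaryGroup.LocalRing L v) (ha : IsUnit a)
          (h : formCongr (conjLocal L (IsCMField.complexConj L) v) T (H.map (algebraMap L (UnitaryGroup.LocalRing L v))) =
            a • (Matrix.of fun i j : Fin 3 => if i.val + j.val + 1 = 3 then (1 : L) else 0).map (algebraMap L (UnitaryGroup.LocalRing L v))),
          ∀ (ψθ : ↥(normOneUnits (conjLocal L (IsCMField.complexConj L) v)) →* ℂˣ) (c : IrrClass (Gqs L v)),
            c.IsConstituentOf (cmPrincipalSeries L 3 v (cmXiTorusChar L v ((toHeckeCharacter L μ).semilocalComponent L v * ((halfModulusChar (UnitaryGroup.LocalRing L v)) ^ 2)⁻¹) ψθ⁻¹ ψθ)) →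
            c.IsConstituentOf (cmPrincipalSeries L 3 v (cmXiTorusChar L v ((toHeckeCharacter L μ).semilocalComponent L v) ψθ⁻¹ ψθ))

set_option synthInstance.maxHeartbeats 400000 in
set_option maxHeartbeats 8000000 in
/-- **THE K1 TARGET** — body of `StubThetaInPS` (`Lines/F0_P2GR91NJacquet.lean` :87–101) VERBATIM (with this file's pasted `CenterCharSpec`).
[cite: GelbartRogawski1991, §5.1 (5.1.1) p. 465, Lem. 5.1.2 pp. 465–466] -/
def K1Target : Prop :=
  ∀ (L : Type) [Field L] [NumberField L] [IsCMField L] (H : Matrix (Fin 3) (Fin 3) L) (hH : (H.map (cmConjRingHom L))ᵀ = H) (hHd : IsUnit H.det)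
    {n' : ℕ} (e₁ : Fin 3 × Fin 1 ≃ Fin n') (dV : Fin 3 → L) (hdV : ∀ i, IsCMField.complexConj L (dV i) = dV i) (hdV0 : ∀ i, dV i ≠ 0) (g : GL (Fin 3) L)
    (hg : ((g : Matrix (Fin 3) (Fin 3) L).map (cmConjRingHom L))ᵀ * H * (g : Matrix (Fin 3) (Fin 3) L) = Matrix.diagonal dV),
    ∀ (μ : Literature.NumberTheory.Automorphic.IdeleClassGroup L →ₜ* Circle) (hμ : IsConjugateSymplectic L μ)
      (χf : UnitaryGroup.finAdelicOne (↥(maximalRealSubfield L)) L (IsCMField.complexConj L) →* ℂˣ),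
      Continuous χf → (∀ z, ‖((χf z : ℂˣ) : ℂ)‖ = 1) →
      ∀ (v : HeightOneSpectrum (𝓞 ↥(maximalRealSubfield L))),
        (∀ w : PlacesOver L v, IsCMField.complexConj L • w.1 = w.1) →
        ∀ (T : GL (Fin 3) (UnitaryGroup.LocalRing L v)) (a : UnitaryGroup.LocalRing L v) (ha : IsUnit a)
          (h : formCongr (conjLocal L (IsCMField.complexConj L) v) T (H.map (algebraMap L (UnitaryGroup.LocalRing L v))) =
            a • (Matrix.of fun i j : Fin 3 => if i.val + j.val + 1 = 3 then (1 : L) else 0).map (algebraMap L (UnitaryGroup.LocalRing L v))),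
          ∃ (ε : (↥(maximalRealSubfield L))ˣ) (x₀ : IrrClass (Gqs L v)) (ψθ : ↥(normOneUnits (conjLocal L (IsCMField.complexConj L) v)) →* ℂˣ),
            CenterCharSpec L μ χf ε v ψθ ∧
            x₀.IsConstituentOf (cmPrincipalSeries L 3 v (cmXiTorusChar L v ((toHeckeCharacter L μ).semilocalComponent L v) ψθ⁻¹ ψθ)) ∧
            ThetaTypeAtCM L H e₁ dV hdV hdV0 g hg μ hμ χf ε v (IrrClass.comap (cmDatumLocalCongr L v T ha h).symm x₀)

/-! ## §3 The stubs (`sorry` = open) -/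

set_option synthInstance.maxHeartbeats 400000 in
set_option maxHeartbeats 16000000 in
open NumberField IsDedekindDomain MeasureTheory Literature.NumberTheory Literature.NumberTheory.Automorphic Literature.NumberTheory.Automorphic.UnitaryGroup Literature.NumberTheory.Automorphic.IdeleClassGroup Literature.NumberTheory.Automorphic.Liu2021 Literature.NumberTheory.Automorphic.Liu2021.Def411WeilCarriers Literature.NumberTheory.Automorphic.Liu2021.Def411WeilCarriersDoubling Literature.NumberTheory.GelbartRogawski1991.UnitaryDualPair Literature.NumberTheory.GelbartRogawski1991.UnitaryDualPair.WeilCoinv Literature.RepresentationTheory.Liu2021 Literature.NumberTheory.GaloisRepresentations Literature.NumberTheory.Rogawski1990 Literature.NumberTheory.GelbartRogawski1991 Literature.RepresentationTheory Summit.HodgeConjecture.HodgeConjecture.Cruxes.H413.F0P2oN3TorusWeightOfD3d in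
/-- **N3 (D) — the torus weight on the Jacquet module, ∀-closed — ★ CLOSED BY NAME** over A-p16 (g24)՚s (5c) ★ p836093 `F0P2oN3TorusWeightHolds.forall_jacquetModule_xThetaGqsCM_torus_eq_smul` (over (5b) ★ p835944 + the (D3d) bricks; edition v3e; no `sorry`): «the diagonal torus element `m(γ) = d(γ, 1, γ̄⁻¹)` (`torusEntry … 1 t = 1`) acts on
`r_N(X_v(μ, ε, χ_f))` by `μ_w(γ)·‖γ‖_w^{1/2}` (`(toHeckeCharacter L μ).semilocalComponent L v γ * halfModulusChar _ γ`)» [Kudla1986 Thm. 2.8; Rogawski1990 §12.2 (2) p. 174; GelbartRogawski1991 §3.2 (3.2.2)].  TEXT = the binder `hD`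
of ★ p835661 TOKEN FOR TOKEN (tree lines :101–:117).  In-house road (D): A-p16 (g24)՚s (5b) CM-package wrapper `Theorems/F0P2oThetaJacquetTorusWeight.lean` ⇒ ★ `F0P2oN3TorusWeightOfD3d.thetaType_nonsplit_jacquetModule_b_of_kerWeight`. -/
theorem stub_N3D_letter :
    ∀ (L : Type) [Field L] [NumberField L] [IsCMField L]
      {n' : ℕ} (e₁ : Fin 3 × Fin 1 ≃ Fin n') (dV : Fin 3 → L) (hdV : ∀ i, IsCMField.complexConj L (dV i) = dV i) (hdV0 : ∀ i, dV i ≠ 0)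
      (μ : Literature.NumberTheory.Automorphic.IdeleClassGroup L →ₜ* Circle) (hμ : IsConjugateSymplectic L μ)
      (χf : UnitaryGroup.finAdelicOne (↥(maximalRealSubfield L)) L (IsCMField.complexConj L) →* ℂˣ),
      Continuous χf → (∀ z, ‖((χf z : ℂˣ) : ℂ)‖ = 1) →
      ∀ (v : HeightOneSpectrum (𝓞 ↥(maximalRealSubfield L))),
        (∀ w : PlacesOver L v, IsCMField.complexConj L • w.1 = w.1) →
        ∀ (ε : (↥(maximalRealSubfield L))ˣ)
          (T : GL (Fin 3) (UnitaryGroup.LocalRing L v)) (a : UnitaryGroup.LocalRing L v) (ha : IsUnit a)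
          (h : formCongr (conjLocal L (IsCMField.complexConj L) v) T ((Matrix.diagonal dV).map (algebraMap L (UnitaryGroup.LocalRing L v))) =
            a • (Matrix.of fun i j : Fin 3 => if i.val + j.val + 1 = 3 then (1 : L) else 0).map (algebraMap L (UnitaryGroup.LocalRing L v)))
          (t : ↥(cmBorelTriple L 3 v).M),
          torusEntry (conjLocal L (IsCMField.complexConj L) v) (cmLocalForm L 3 v) 1 t = 1 →
          ∀ x : ((cmBorelTriple L 3 v).restrict (xThetaGqsCM L e₁ dV hdV hdV0 μ hμ χf ε v T ha h)).Coinvariants,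
            Representation.jacquetModule (xThetaGqsCM L e₁ dV hdV hdV0 μ hμ χf ε v T ha h) (cmBorelTriple L 3 v) t x =
              (((toHeckeCharacter L μ).semilocalComponent L v (torusEntry (conjLocal L (IsCMField.complexConj L) v) (cmLocalForm L 3 v) 0 t) *
                  halfModulusChar (UnitaryGroup.LocalRing L v) (torusEntry (conjLocal L (IsCMField.complexConj L) v) (cmLocalForm L 3 v) 0 t) : ℂˣ) : ℂ) • x :=
  Summit.HodgeConjecture.HodgeConjecture.Cruxes.H413.F0P2oN3TorusWeightHolds.forall_jacquetModule_xThetaGqsCM_torus_eq_smul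

/-- **THE N3 LETTER — ★ CLOSED BY NAME, HYPOTHESIS-FREE** (edition v3f «N3 DIRECT FOLD» over ★ p839151 F0P2-p06 (g4) `Theorems/F0P2oLineJacquetHolds.lean :: thetaType_nonsplit_jacquetModule_holds` (the (JA) junction over ★ (C5) p838835 B-p10 (g23), ★ (C6)∕(J1)–(J4) p838314 B-p14 (g29) + `F0P2oLineJacquetReindex`, ★ (BE) p838099∕p838184 B-p18 (g29), ★ (N′) p837961 F0P2-p06 (g4), ★ (LS) p836839, ★ (LM) p836568, ★ (FX)(CC) p837171∕p837965, ★ (BF) p837182, ★ (BD) p838316, ★ (IB) p838392, ★ (KL) p838305, ★ (SJ-gen) p838357; lead B-p18 (g29) socket (B) word 2026-08-31T23:47:37Z) — the η-free (N′) line-Jacquet road; the clause-(a) stub `stub_N3a_letter` of v3e is DROPPED, `stub_N3D_letter` stays ★ by name; WAS: (D) proved in tree; edition v3e over ★ p835661 `F0P2oN3OfTorusWeight.thetaType_nonsplit_jacquetModule_of_a_of_torusWeight stub_N3a_letter stub_N3D_letter`; the whole letter was a print letter by name before) — (edition v3c): [GelbartRogawski1991 §3.2 (3.2.1)–(3.2.2)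 p. 457; Kudla1986 Thm. 2.8] the Jacquet module of the local theta type
`X_v(μ, ε, χ_f)` along the Borel at a non-split place (top quotient `μ‖·‖^{1/2} ⊗ ω¹(γ_v, ψ_v)`), ★-typed p826177 (typ-T7a (g0))
`Literature/NumberTheory/GelbartRogawski1991/ThetaTypeNonsplitJacquetModule.lean` — a `def … : Prop` named fact (print row N3; N3ᵟ is its ★ consequence p827685, not a separate row). Statement unchanged; no `sorry`. -/
theorem stub_N3_letter : Literature.NumberTheory.GelbartRogawski1991.thetaType_nonsplit_jacquetModule :=
  Summit.HodgeConjecture.HodgeConjecture.Cruxes.H413.F0P2oLineJacquetHolds.thetaType_nonsplit_jacquetModule_holds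

/-- **THE U1 LETTER — ★ CLOSED BY NAME MODULO N3 ONLY** (edition v3d over ★ p833094 `F0P2pGR91NOfN3.u1ThetaDichotomy_nonsplit_of_N3 stub_N3_letter`; print letter by name at v3c): [HarrisKudlaSweet1996 Cor. 4.4 p. 962 (m = n = 1); Rogawski1992 Prop. 3.4] the `(U(1), U(1))` theta dichotomy at a
non-split place (two-sided existence form over ★ `OccursInLineWeilCM`), ★-typed p826953 ∕ ED.2 p827180 (typ-T7b (g0)) `Literature/NumberTheory/GelbartRogawski1991/U1ThetaDichotomy.lean`
— a `def … : Prop` named fact (print row U1; in-house residual «U1-DISJOINT», road (T) «up the tower»: A-p12 step (6) `F0P2oU1DichotomyOfDisjoint`, p01 steps (4)+(1) — ★ COMPLETE: p829230 tower ∘ p832406∕p833741 CM head ∘ p832625 N1). Statement unchanged; no `sorry`. -/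
theorem stub_U1_letter : Literature.NumberTheory.GelbartRogawski1991.u1ThetaDichotomy_nonsplit :=
  Summit.HodgeConjecture.HodgeConjecture.Cruxes.H413.F0P2pGR91NOfN3.u1ThetaDichotomy_nonsplit_of_N3 stub_N3_letter

set_option synthInstance.maxHeartbeats 400000 in
set_option maxHeartbeats 8000000 in
/-- stub K1aʷ — ★ CLOSED BY NAME OVER THE LETTERS N3 + U1 (edition v3c): B-p18 (g28) p828026 `Theorems/F0P2oK1aWOfLetters.lean :: stubK1aW_of_letters (hN3) (hU1)`
(`ψθ := (χ_{f,v} ∘ θ₁ ∘ ι)·(μ_v|_{E¹_v})⁻¹` satisfies the centre-character constraint at EVERY line; the occurring line from U1 via ★ `F0P2oK1occ.k1occ_of_u1ThetaDichotomy`;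
the `(B, χθʷ·δ_B^{1/2})`-eigenfunctional from N3 via ★ `F0P2oBorelEigenfunctionalOfJacquetModule.thetaType_nonsplit_borelEigenfunctional_of_jacquetModule`).
`CenterCharSpec` (§1) and the closer's ★ `IsThetaCenterChar` are token-identical bodies: the fold is by δ-unfolding. -/
theorem stub_K1aW : StubK1aWJacquetFunctional :=
  F0P2oK1aWOfLetters.stubK1aW_of_letters stub_N3_letter stub_U1_letter

/-- **THE K1w LETTER — ★ CLOSED BY NAME, HYPOTHESIS-FREE** (edition v3d over ★ p833012 `F0P2pK1wHolds.cmPrincipalSeries_isConstituentOf_weylConj_holds`; print letter by name at v3): [Rogawski1990 §12.2 p. 174 L3–5; BernsteinZelevinsky1977 Thm. 2.9] `JH(i_G(χ)) = JH(i_G(wχ))` for `U(Φ₃)(L⁺_v)`,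
★-typed p826332 (typ-T7a (g0)) `Literature/NumberTheory/Rogawski1990/U3PrincipalSeriesWeylConjugate.lean` — a `def … : Prop` named fact (net print debt +1, the pay-down's
declared generic residue) — PROVED IN-HOUSE by F0P2-p06՚s K1w chain ★ F1 … F4c p832032 over ★ p832625 N1; the K1w branch has NO `sorry` left. Statement unchanged. -/
theorem stub_K1w_letter : Literature.NumberTheory.Rogawski1990.cmPrincipalSeries_isConstituentOf_weylConj :=
  Summit.HodgeConjecture.HodgeConjecture.Cruxes.H413.F0P2pK1wHolds.cmPrincipalSeries_isConstituentOf_weylConj_holds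

set_option synthInstance.maxHeartbeats 400000 in
set_option maxHeartbeats 8000000 in
/-- stub K1w — ★ CLOSED BY NAME OVER THE LETTER (edition v3): F0P2-p02 (g5) p826576 `Theorems/F0P2oK1wOfWeylConj.lean :: stubK1w_of_weylConj (hW)`
(`‖σ a‖ = ‖a‖` for continuous ring involutions, `μ_v(x̄) = μ_v(x)⁻¹` for conjugate-symplectic `μ`, `((χ₁θʷ) ∘ σ)⁻¹ = χ₁θ`; fold cert by paste 0994bb5690a983fe). -/
theorem stub_K1w : StubK1wWeylSymmetric :=
  F0P2oK1wOfWeylConj.stubK1w_of_weylConj stub_K1w_letter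

set_option synthInstance.maxHeartbeats 400000 in
set_option maxHeartbeats 8000000 in
/-- stub K1c — ★ CLOSED BY NAME, LETTER-FREE (edition v3b): F0P2-p05 (g0) `Theorems/F0P2oXThetaOwnClass.lean :: stubK1c_holds`. -/
theorem stub_K1c : StubK1cOwnClass :=
  F0P2oXThetaOwnClass.stubK1c_holds

/-! ## §4 The head (kernel-checked; no `sorry` below this line) -/

set_option synthInstance.maxHeartbeats 400000 in
set_option maxHeartbeats 16000000 in
/-- **K1 from K1a + K1c over ★ K1b.** [cite: GelbartRogawski1991, §5.1 Lem. 5.1.2 pp. 465–466] [cite: Rogawski1990, §12.2 (2) p. 174] -/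
theorem k1_of_stubs (hA : StubK1aWJacquetFunctional) (hW : StubK1wWeylSymmetric) (hC : StubK1cOwnClass) : K1Target := by
  intro L _ _ _ H hH hHd n' e₁ dV hdV hdV0 g hg μ hμ χf hcont hunit v hv T a ha h
  obtain ⟨ε, ψθ, hspec, ℓ, hℓ0, hℓ⟩ := hA L H hH hHd e₁ dV hdV hdV0 g hg μ hμ χf hcont hunit v hv T a ha h
  obtain ⟨hirr, hsm, hθ⟩ := hC L H hH hHd e₁ dV hdV hdV0 g hg μ hμ χf hcont hunit v hv T a ha h ε
  refine ⟨ε, _, ψθ, hspec, ?_, hθ⟩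
  exact hW L H hH hHd e₁ dV hdV hdV0 g hg μ hμ χf hcont hunit v hv T a ha h ψθ _
    (F0P2nFrobeniusFunctional.isConstituentOf_mk_cmPrincipalSeries_xi_of_functional L v _ ψθ⁻¹ ψθ _ hirr hsm ℓ hℓ hℓ0)

/-- the concluder over the registered stubs (fold target of `stub_thetaType_in_principalSeries`). -/
theorem k1_of_stubs_registered : K1Target := k1_of_stubs stub_K1aW stub_K1w stub_K1c

end Summit.HodgeConjecture.HodgeConjecture.Cruxes.H413.F0P2GR91NJacquetK1

end
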